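import Mathlib
import Summits.Ventures.PercRepro2.HCov
import Summits.Ventures.PercRepro2.HCovCubic
import Summits.Ventures.PercRepro2.TriDisagreement
import Summits.Ventures.PercRepro2.TriDisagreementPinned
import Summits.Ventures.PercRepro2.TypedSplit
import Summits.Ventures.PercRepro2.OneTypedEdge
import Summits.Ventures.PercRepro2.StarPattern
import Summits.Ventures.PercRepro2.StarIdentities
import Summits.Ventures.PercRepro2.StarDebt
import Summits.Ventures.PercRepro2.ChainCoeff
import Summits.Ventures.PercRepro2.StarChain
import Summits.Ventures.PercRepro2.StarPayment

/-!
# The refinement lattice of a triple at a degree-three star, in orbit leaves (blind cell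
PercRepro2, p1 g12; LEAD-CCW (c⁗⁗⁗) «supermodularity of nested addition», «complete monotonicity»,
«what complete monotonicity says in leaves»; CONJECTURES row 2′REFINE)

For the triple `T = 012` of the star and a set `X` of its pairs, the lead's set function
`f(X) = B(G′ + T_{t_S} + X_k)` (the typed base of `G − y` with `T` as a type-`t_S` hyperedge and the
pairs of `X` as type-`k` hyperedges) is, in the star vocabulary, the placement sum of the blocks
over the copies with merging (`Bplace2` / `Bplace3` / `Bplace4`: two / three / four blocks with
their placement sets — `Bindep3` of `StarPayment.lean` is `Bplace3` with three type-`1`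
placements; singleton blocks do not occur, so no pendant closure is needed). The twenty-one
identities `refine_{t_S k}_X` write every `f(X)` in orbit leaves (`Bone`, `Btype2`, `Bfull P` =
`Λ(P;P;P)`, `Ltt P Q` = `Λ(P;P;Q)`, `Bthree`), so the MÖBIUS COEFFICIENTS
`g(Y) = Σ_{Z ⊆ Y} (−1)^{|Y∖Z|} f(Z)` of row 2′REFINE are leaf sums (kernel-checked):

* `(1,1)`: `g(a) = Λ(T;a;∅)` (NM), **`g(ab) = Λ(T;a;b) + 2 B(T₂)`** (supermodularity — the ONE
  antichain coefficient of the family, `moebius_11_two`), `g(abc) = 2 B(T₂) + 2 Σ_c Λ(T;T;c)`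
  (`moebius_11_three`);
* `(2,1)`: `g(a) = Λ(T;T;a) + B(T₂)`, `g(ab) = 3 B(T₃) + Λ(T;T;a) + Λ(T;T;b) + B(T₂)`,
  `g(abc) = 12 B(T₃) + 3 Σ_c Λ(T;T;c) + B(T₂)` — chain leaves only;
* `(2,2)`: `g(a) = 2 Λ(T;T;a)`, `g(ab) = 12 B(T₃)`, `g(abc) = 24 B(T₃)` — chain leaves only.

So at `(2,1)` and `(2,2)` complete monotonicity of the triple is a consequence of chain positivity
alone, and at `(1,1)` it is chain positivity plus the single payment
`Λ(T;a;b) + 2 B(T₂) ≥ 0` (`supermodular_11_iff`). Finally the payment principle in the lead's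
refinement form: `Pay222 ↔ ∃ a ≠ b, f(a) + f(b) ≤ B(△₁) + f(∅)` (`pay222_iff_refine`). Identities
only; no sign claim is made.
-/

namespace Summit.Ventures.PercRepro2

open CovForm CovForm.OneTyped CovForm.TypedRed

namespace StarPattern

section Defs

variable {V : Type*} {E : Type*} [Fintype E] [DecidableEq E] {R : Type*} [Field R]

/-- `Λ(P;P;P)`: the block `P` in all three copies (the type-`3` base `B(P₃)`). -/
noncomputable def Bfull (ends : E → Sym2 V) (o a₁ a₂ a₃ b : V) (s₁ s₂ s₃ : E) (F₀ : Finset E)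
    (z₀ : Config E) (τ : E → ℕ) (P : Bool × Bool × Bool) : R :=
  patCount ends o a₁ a₂ a₃ b s₁ s₂ s₃ F₀ z₀ τ P P P

/-- `Λ(P;P;Q)`: the block `P` in two copies and `Q` in the third (three orderings). -/
noncomputable def Ltt (ends : E → Sym2 V) (o a₁ a₂ a₃ b : V) (s₁ s₂ s₃ : E) (F₀ : Finset E)
    (z₀ : Config E) (τ : E → ℕ) (P Q : Bool × Bool × Bool) : R :=
  patCount ends o a₁ a₂ a₃ b s₁ s₂ s₃ F₀ z₀ τ P P Q +
    patCount ends o a₁ a₂ a₃ b s₁ s₂ s₃ F₀ z₀ τ P Q P +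
    patCount ends o a₁ a₂ a₃ b s₁ s₂ s₃ F₀ z₀ τ Q P P

/-- **Two blocks with placement sets** `A`, `B` (each block open in the copies of its placement;
blocks in a common copy merge). -/
noncomputable def Bplace2 (ends : E → Sym2 V) (o a₁ a₂ a₃ b : V) (s₁ s₂ s₃ : E) (F₀ : Finset E)
    (z₀ : Config E) (τ : E → ℕ) (P Q : Bool × Bool × Bool) (A B : Finset (Bool × Bool × Bool)) :
    R :=
  ∑ p ∈ A, ∑ q ∈ B,
    patCount ends o a₁ a₂ a₃ b s₁ s₂ s₃ F₀ z₀ τ (orU (onCopy P p.1) (onCopy Q q.1))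
      (orU (onCopy P p.2.1) (onCopy Q q.2.1)) (orU (onCopy P p.2.2) (onCopy Q q.2.2))

/-- **Three blocks with placement sets.** -/
noncomputable def Bplace3 (ends : E → Sym2 V) (o a₁ a₂ a₃ b : V) (s₁ s₂ s₃ : E) (F₀ : Finset E)
    (z₀ : Config E) (τ : E → ℕ) (P Q S : Bool × Bool × Bool)
    (A B C : Finset (Bool × Bool × Bool)) : R :=
  ∑ p ∈ A, ∑ q ∈ B, ∑ s ∈ C,
    patCount ends o a₁ a₂ a₃ b s₁ s₂ s₃ F₀ z₀ τ
      (orU (onCopy P p.1) (orU (onCopy Q q.1) (onCopy S s.1)))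
      (orU (onCopy P p.2.1) (orU (onCopy Q q.2.1) (onCopy S s.2.1)))
      (orU (onCopy P p.2.2) (orU (onCopy Q q.2.2) (onCopy S s.2.2)))

/-- **Four blocks with placement sets.** -/
noncomputable def Bplace4 (ends : E → Sym2 V) (o a₁ a₂ a₃ b : V) (s₁ s₂ s₃ : E) (F₀ : Finset E)
    (z₀ : Config E) (τ : E → ℕ) (P Q S W : Bool × Bool × Bool)
    (A B C D : Finset (Bool × Bool × Bool)) : R :=
  ∑ p ∈ A, ∑ q ∈ B, ∑ s ∈ C, ∑ w ∈ D,
    patCount ends o a₁ a₂ a₃ b s₁ s₂ s₃ F₀ z₀ τ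
      (orU (onCopy P p.1) (orU (onCopy Q q.1) (orU (onCopy S s.1) (onCopy W w.1))))
      (orU (onCopy P p.2.1) (orU (onCopy Q q.2.1) (orU (onCopy S s.2.1) (onCopy W w.2.1))))
      (orU (onCopy P p.2.2) (orU (onCopy Q q.2.2) (orU (onCopy S s.2.2) (onCopy W w.2.2))))

/-- `Bindep3` is `Bplace3` with three type-`1` placements. -/
theorem Bindep3_eq_Bplace3 (ends : E → Sym2 V) (o a₁ a₂ a₃ b : V) (s₁ s₂ s₃ : E) (F₀ : Finset E)
    (z₀ : Config E) (τ : E → ℕ) (P Q S : Bool × Bool × Bool) :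
    Bindep3 (R := R) ends o a₁ a₂ a₃ b s₁ s₂ s₃ F₀ z₀ τ P Q S =
      Bplace3 ends o a₁ a₂ a₃ b s₁ s₂ s₃ F₀ z₀ τ P Q S placements placements placements := rfl

end Defs

section Identities

variable {V : Type*} {E : Type*} [Fintype E] [DecidableEq E] {R : Type*} [Field R]

/-- `f(01)` at `(t_S, k) = (1, 1)`: 2 orbits, 9 placements. -/
theorem refine_11_01 (ends : E → Sym2 V) (o a₁ a₂ a₃ b : V) (s₁ s₂ s₃ : E) (F₀ : Finset E)
    (z₀ : Config E) (τ : E → ℕ) :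
    Bplace2 (R := R) ends o a₁ a₂ a₃ b s₁ s₂ s₃ F₀ z₀ τ
       (true, true, true) (true, true, false) placements placements =
      Bthree ends o a₁ a₂ a₃ b s₁ s₂ s₃ F₀ z₀ τ
         (true, true, true) (true, true, false) (false, false, false) +
      Bone ends o a₁ a₂ a₃ b s₁ s₂ s₃ F₀ z₀ τ
         (true, true, true) := by
  unfold Bplace2
  simp only [sum_placements]
  simp only [onCopy, orU, Bool.and_true, Bool.and_false, Bool.or_true, Bool.or_false]
  unfold Bone Bthree
  ring

/-- `f(02)` at `(t_S, k) = (1, 1)`: 2 orbits, 9 placements. -/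
theorem refine_11_02 (ends : E → Sym2 V) (o a₁ a₂ a₃ b : V) (s₁ s₂ s₃ : E) (F₀ : Finset E)
    (z₀ : Config E) (τ : E → ℕ) :
    Bplace2 (R := R) ends o a₁ a₂ a₃ b s₁ s₂ s₃ F₀ z₀ τ
       (true, true, true) (true, false, true) placements placements =
      Bthree ends o a₁ a₂ a₃ b s₁ s₂ s₃ F₀ z₀ τ
         (true, true, true) (true, false, true) (false, false, false) +
      Bone ends o a₁ a₂ a₃ b s₁ s₂ s₃ F₀ z₀ τ
         (true, true, true) := by
  unfold Bplace2
  simp only [sum_placements]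
  simp only [onCopy, orU, Bool.and_true, Bool.and_false, Bool.or_true, Bool.or_false]
  unfold Bone Bthree
  ring

/-- `f(12)` at `(t_S, k) = (1, 1)`: 2 orbits, 9 placements. -/
theorem refine_11_12 (ends : E → Sym2 V) (o a₁ a₂ a₃ b : V) (s₁ s₂ s₃ : E) (F₀ : Finset E)
    (z₀ : Config E) (τ : E → ℕ) :
    Bplace2 (R := R) ends o a₁ a₂ a₃ b s₁ s₂ s₃ F₀ z₀ τ
       (true, true, true) (false, true, true) placements placements =
      Bthree ends o a₁ a₂ a₃ b s₁ s₂ s₃ F₀ z₀ τ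
         (true, true, true) (false, true, true) (false, false, false) +
      Bone ends o a₁ a₂ a₃ b s₁ s₂ s₃ F₀ z₀ τ
         (true, true, true) := by
  unfold Bplace2
  simp only [sum_placements]
  simp only [onCopy, orU, Bool.and_true, Bool.and_false, Bool.or_true, Bool.or_false]
  unfold Bone Bthree
  ring

/-- `f(01, 02)` at `(t_S, k) = (1, 1)`: 5 orbits, 27 placements. -/
theorem refine_11_0102 (ends : E → Sym2 V) (o a₁ a₂ a₃ b : V) (s₁ s₂ s₃ : E) (F₀ : Finset E)
    (z₀ : Config E) (τ : E → ℕ) :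
    Bplace3 (R := R) ends o a₁ a₂ a₃ b s₁ s₂ s₃ F₀ z₀ τ
       (true, true, true) (true, true, false) (true, false, true)
      placements placements placements =
      Bthree ends o a₁ a₂ a₃ b s₁ s₂ s₃ F₀ z₀ τ
         (true, true, true) (true, false, true) (true, true, false) +
      2 * (Btype2 ends o a₁ a₂ a₃ b s₁ s₂ s₃ F₀ z₀ τ
         (true, true, true)) +
      Bthree ends o a₁ a₂ a₃ b s₁ s₂ s₃ F₀ z₀ τ
         (true, true, true) (true, true, false) (false, false, false) +
      Bthree ends o a₁ a₂ a₃ b s₁ s₂ s₃ F₀ z₀ τ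
         (true, true, true) (true, false, true) (false, false, false) +
      Bone ends o a₁ a₂ a₃ b s₁ s₂ s₃ F₀ z₀ τ
         (true, true, true) := by
  unfold Bplace3
  simp only [sum_placements]
  simp only [onCopy, orU, Bool.and_true, Bool.and_false, Bool.or_true, Bool.or_false]
  unfold Bone Btype2 Bthree
  ring

/-- `f(01, 12)` at `(t_S, k) = (1, 1)`: 5 orbits, 27 placements. -/
theorem refine_11_0112 (ends : E → Sym2 V) (o a₁ a₂ a₃ b : V) (s₁ s₂ s₃ : E) (F₀ : Finset E)
    (z₀ : Config E) (τ : E → ℕ) :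
    Bplace3 (R := R) ends o a₁ a₂ a₃ b s₁ s₂ s₃ F₀ z₀ τ
       (true, true, true) (true, true, false) (false, true, true)
      placements placements placements =
      Bthree ends o a₁ a₂ a₃ b s₁ s₂ s₃ F₀ z₀ τ
         (true, true, true) (false, true, true) (true, true, false) +
      2 * (Btype2 ends o a₁ a₂ a₃ b s₁ s₂ s₃ F₀ z₀ τ
         (true, true, true)) +
      Bthree ends o a₁ a₂ a₃ b s₁ s₂ s₃ F₀ z₀ τ
         (true, true, true) (true, true, false) (false, false, false) +
      Bthree ends o a₁ a₂ a₃ b s₁ s₂ s₃ F₀ z₀ τ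
         (true, true, true) (false, true, true) (false, false, false) +
      Bone ends o a₁ a₂ a₃ b s₁ s₂ s₃ F₀ z₀ τ
         (true, true, true) := by
  unfold Bplace3
  simp only [sum_placements]
  simp only [onCopy, orU, Bool.and_true, Bool.and_false, Bool.or_true, Bool.or_false]
  unfold Bone Btype2 Bthree
  ring

/-- `f(02, 12)` at `(t_S, k) = (1, 1)`: 5 orbits, 27 placements. -/
theorem refine_11_0212 (ends : E → Sym2 V) (o a₁ a₂ a₃ b : V) (s₁ s₂ s₃ : E) (F₀ : Finset E)
    (z₀ : Config E) (τ : E → ℕ) :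
    Bplace3 (R := R) ends o a₁ a₂ a₃ b s₁ s₂ s₃ F₀ z₀ τ
       (true, true, true) (true, false, true) (false, true, true)
      placements placements placements =
      Bthree ends o a₁ a₂ a₃ b s₁ s₂ s₃ F₀ z₀ τ
         (true, true, true) (false, true, true) (true, false, true) +
      2 * (Btype2 ends o a₁ a₂ a₃ b s₁ s₂ s₃ F₀ z₀ τ
         (true, true, true)) +
      Bthree ends o a₁ a₂ a₃ b s₁ s₂ s₃ F₀ z₀ τ
         (true, true, true) (true, false, true) (false, false, false) +
      Bthree ends o a₁ a₂ a₃ b s₁ s₂ s₃ F₀ z₀ τ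
         (true, true, true) (false, true, true) (false, false, false) +
      Bone ends o a₁ a₂ a₃ b s₁ s₂ s₃ F₀ z₀ τ
         (true, true, true) := by
  unfold Bplace3
  simp only [sum_placements]
  simp only [onCopy, orU, Bool.and_true, Bool.and_false, Bool.or_true, Bool.or_false]
  unfold Bone Btype2 Bthree
  ring

/-- `f(01, 02, 12)` at `(t_S, k) = (1, 1)`: 11 orbits, 81 placements. -/
theorem refine_11_010212 (ends : E → Sym2 V) (o a₁ a₂ a₃ b : V) (s₁ s₂ s₃ : E) (F₀ : Finset E)
    (z₀ : Config E) (τ : E → ℕ) :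
    Bplace4 (R := R) ends o a₁ a₂ a₃ b s₁ s₂ s₃ F₀ z₀ τ
       (true, true, true) (true, true, false) (true, false, true) (false, true, true)
      placements placements placements placements =
      2 * (Ltt ends o a₁ a₂ a₃ b s₁ s₂ s₃ F₀ z₀ τ
         (true, true, true) (true, true, false)) +
      2 * (Ltt ends o a₁ a₂ a₃ b s₁ s₂ s₃ F₀ z₀ τ
         (true, true, true) (true, false, true)) +
      2 * (Ltt ends o a₁ a₂ a₃ b s₁ s₂ s₃ F₀ z₀ τ
         (true, true, true) (false, true, true)) +
      Bthree ends o a₁ a₂ a₃ b s₁ s₂ s₃ F₀ z₀ τ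
         (true, true, true) (true, false, true) (true, true, false) +
      Bthree ends o a₁ a₂ a₃ b s₁ s₂ s₃ F₀ z₀ τ
         (true, true, true) (false, true, true) (true, true, false) +
      Bthree ends o a₁ a₂ a₃ b s₁ s₂ s₃ F₀ z₀ τ
         (true, true, true) (false, true, true) (true, false, true) +
      8 * (Btype2 ends o a₁ a₂ a₃ b s₁ s₂ s₃ F₀ z₀ τ
         (true, true, true)) +
      Bthree ends o a₁ a₂ a₃ b s₁ s₂ s₃ F₀ z₀ τ
         (true, true, true) (true, true, false) (false, false, false) +
      Bthree ends o a₁ a₂ a₃ b s₁ s₂ s₃ F₀ z₀ τ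
         (true, true, true) (true, false, true) (false, false, false) +
      Bthree ends o a₁ a₂ a₃ b s₁ s₂ s₃ F₀ z₀ τ
         (true, true, true) (false, true, true) (false, false, false) +
      Bone ends o a₁ a₂ a₃ b s₁ s₂ s₃ F₀ z₀ τ
         (true, true, true) := by
  unfold Bplace4
  simp only [sum_placements]
  simp only [onCopy, orU, Bool.and_true, Bool.and_false, Bool.or_true, Bool.or_false]
  unfold Bone Btype2 Ltt Bthree
  ring

end Identities

section Moebius

variable {V : Type*} {E : Type*} [Fintype E] [DecidableEq E] {R : Type*} [Field R]

/-- `Λ(T;a;∅)` is the exclusive nested leaf `E(T; a)`. -/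
theorem Bthree_T_empty_eq_nestLeaf (ends : E → Sym2 V) (o a₁ a₂ a₃ b : V) (s₁ s₂ s₃ : E) (F₀ :
  Finset E)
    (z₀ : Config E) (τ : E → ℕ) (a : Bool × Bool × Bool) :
    Bthree (R := R) ends o a₁ a₂ a₃ b s₁ s₂ s₃ F₀ z₀ τ (true, true, true) a (false, false, false) =
      nestLeaf ends o a₁ a₂ a₃ b s₁ s₂ s₃ F₀ z₀ τ a := by
  unfold nestLeaf; rw [chainCoeff_one_one_one]; unfold Bthree; ring

/-- `f(a) = B(T₁ + a₁)` is the two-hyperedge base `B(a₁, T₁)`. -/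
theorem Bplace2_T_eq_Btwo (ends : E → Sym2 V) (o a₁ a₂ a₃ b : V) (s₁ s₂ s₃ : E) (F₀ : Finset E)
    (z₀ : Config E) (τ : E → ℕ) (a : Bool × Bool × Bool) :
    Bplace2 (R := R) ends o a₁ a₂ a₃ b s₁ s₂ s₃ F₀ z₀ τ (true, true, true) a placements placements =
      Btwo ends o a₁ a₂ a₃ b s₁ s₂ s₃ F₀ z₀ τ a (true, true, true) := by
  obtain ⟨a1, a2, a3⟩ := a
  unfold Bplace2 Btwo
  simp only [sum_placements]
  simp only [onCopy, orU, Bool.and_true, Bool.and_false, Bool.or_true, Bool.false_or, Bool.true_or]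
  ring

/-- **The first Möbius coefficient at `(1,1)`** is the nested leaf `f(a) − f(∅) = Λ(T;a;∅)` (NM). -/
theorem moebius_11_one (ends : E → Sym2 V) (o a₁ a₂ a₃ b : V) (s₁ s₂ s₃ : E) (F₀ : Finset E)
    (z₀ : Config E) (τ : E → ℕ) :
    Bplace2 (R := R) ends o a₁ a₂ a₃ b s₁ s₂ s₃ F₀ z₀ τ (true, true, true) (true, true, false)
      placements placements - Bone (R := R) ends o a₁ a₂ a₃ b s₁ s₂ s₃ F₀ z₀ τ (true, true, true) =
      Bthree ends o a₁ a₂ a₃ b s₁ s₂ s₃ F₀ z₀ τ (true, true, true) (true, true, false)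
      (false, false, false) := by
  rw [refine_11_01]; ring

/-- **The second Möbius coefficient at `(1,1)`** (supermodularity):
`f(ab) − f(a) − f(b) + f(∅) = Λ(T;a;b) + 2 B(T₂)` — the ONE antichain coefficient of the family. -/
theorem moebius_11_two (ends : E → Sym2 V) (o a₁ a₂ a₃ b : V) (s₁ s₂ s₃ : E) (F₀ : Finset E)
    (z₀ : Config E) (τ : E → ℕ) :
    Bplace3 (R := R) ends o a₁ a₂ a₃ b s₁ s₂ s₃ F₀ z₀ τ (true, true, true) (true, true, false)
      (true, false, true) placements placements placements - Bplace2 (R := R) ends o a₁ a₂ a₃ b s₁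
      s₂ s₃ F₀ z₀ τ (true, true, true) (true, true, false) placements placements - Bplace2 (R := R)
      ends o a₁ a₂ a₃ b s₁ s₂ s₃ F₀ z₀ τ (true, true, true) (true, false, true) placements
      placements + Bone (R := R) ends o a₁ a₂ a₃ b s₁ s₂ s₃ F₀ z₀ τ (true, true, true) =
      Bthree ends o a₁ a₂ a₃ b s₁ s₂ s₃ F₀ z₀ τ (true, true, true) (true, false, true)
        (true, true, false) + 2 * Btype2 ends o a₁ a₂ a₃ b s₁ s₂ s₃ F₀ z₀ τ (true, true, true) := by
  rw [refine_11_0102, refine_11_01, refine_11_02]; ring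

/-- **The third Möbius coefficient at `(1,1)`**: `g(abc) = 2 B(T₂) + 2 Σ_c Λ(T;T;c)` (chains). -/
theorem moebius_11_three (ends : E → Sym2 V) (o a₁ a₂ a₃ b : V) (s₁ s₂ s₃ : E) (F₀ : Finset E)
    (z₀ : Config E) (τ : E → ℕ) :
    Bplace4 (R := R) ends o a₁ a₂ a₃ b s₁ s₂ s₃ F₀ z₀ τ (true, true, true) (true, true, false)
      (true, false, true) (false, true, true) placements placements placements placements - (Bplace3
      (R := R) ends o a₁ a₂ a₃ b s₁ s₂ s₃ F₀ z₀ τ (true, true, true) (true, true, false)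
      (true, false, true) placements placements placements + Bplace3 (R := R) ends o a₁ a₂ a₃ b s₁
      s₂ s₃ F₀ z₀ τ (true, true, true) (true, true, false) (false, true, true) placements placements
      placements + Bplace3 (R := R) ends o a₁ a₂ a₃ b s₁ s₂ s₃ F₀ z₀ τ (true, true, true)
      (true, false, true) (false, true, true) placements placements placements) +
      (Bplace2 (R := R) ends o a₁ a₂ a₃ b s₁ s₂ s₃ F₀ z₀ τ (true, true, true) (true, true, false)
        placements placements + Bplace2 (R := R) ends o a₁ a₂ a₃ b s₁ s₂ s₃ F₀ z₀ τ
        (true, true, true) (true, false, true) placements placements + Bplace2 (R := R) ends o a₁ a₂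
        a₃ b s₁ s₂ s₃ F₀ z₀ τ (true, true, true) (false, true, true) placements placements) - Bone
        (R := R) ends o a₁ a₂ a₃ b s₁ s₂ s₃ F₀ z₀ τ (true, true, true) =
      2 * Btype2 ends o a₁ a₂ a₃ b s₁ s₂ s₃ F₀ z₀ τ (true, true, true) + 2 * (Ltt ends o a₁ a₂ a₃ b
        s₁ s₂ s₃ F₀ z₀ τ (true, true, true) (true, true, false) + Ltt ends o a₁ a₂ a₃ b s₁ s₂ s₃ F₀
        z₀ τ (true, true, true) (true, false, true) + Ltt ends o a₁ a₂ a₃ b s₁ s₂ s₃ F₀ z₀ τ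
        (true, true, true) (false, true, true)) := by
  rw [refine_11_010212, refine_11_0102, refine_11_0112, refine_11_0212, refine_11_01, refine_11_02,
    refine_11_12]
  ring

end Moebius

section Signs

variable {V : Type*} {E : Type*} [Fintype E] [DecidableEq E] {R : Type*} [Field R] [LinearOrder R]
  [IsStrictOrderedRing R]

/-- **Supermodularity at `(1,1)` is the payment `Λ(T;a;b) + 2 B(T₂) ≥ 0`** (the lead's
«supermodularity ⟺ Λ(S;a;b) + 2B(S₂) ≥ 0»), for the pair `a = 01`, `b = 02`. -/
theorem supermodular_11_iff (ends : E → Sym2 V) (o a₁ a₂ a₃ b : V) (s₁ s₂ s₃ : E) (F₀ : Finset E)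
    (z₀ : Config E) (τ : E → ℕ) :
    Bplace2 (R := R) ends o a₁ a₂ a₃ b s₁ s₂ s₃ F₀ z₀ τ (true, true, true) (true, true, false)
      placements placements + Bplace2 (R := R) ends o a₁ a₂ a₃ b s₁ s₂ s₃ F₀ z₀ τ (true, true, true)
      (true, false, true) placements placements ≤ Bplace3 (R := R) ends o a₁ a₂ a₃ b s₁ s₂ s₃ F₀ z₀
      τ (true, true, true) (true, true, false) (true, false, true) placements placements placements
      + Bone (R := R) ends o a₁ a₂ a₃ b s₁ s₂ s₃ F₀ z₀ τ (true, true, true) ↔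
      0 ≤ Bthree (R := R) ends o a₁ a₂ a₃ b s₁ s₂ s₃ F₀ z₀ τ (true, true, true) (true, false, true)
        (true, true, false) + 2 * Btype2 ends o a₁ a₂ a₃ b s₁ s₂ s₃ F₀ z₀ τ (true, true, true) := by
  have h := moebius_11_two (R := R) ends o a₁ a₂ a₃ b s₁ s₂ s₃ F₀ z₀ τ
  constructor
  · intro h1; linarith
  · intro h1; linarith

/-- **The payment principle in the lead's refinement form**: `Pay222` holds iff for SOME two
pairs `a ≠ b` of the triple, `f(a) + f(b) ≤ B(△₁) + f(∅)` («PAY222 ⟺ B(△₁) + f(∅) ≥ f(a) + f(b)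
for some two pairs»). -/
theorem pay222_iff_refine (ends : E → Sym2 V) (o a₁ a₂ a₃ b : V) (s₁ s₂ s₃ : E) (F₀ : Finset E)
    (z₀ : Config E) (τ : E → ℕ) :
    Pay222 (R := R) ends o a₁ a₂ a₃ b s₁ s₂ s₃ F₀ z₀ τ ↔
      (Bplace2 (R := R) ends o a₁ a₂ a₃ b s₁ s₂ s₃ F₀ z₀ τ (true, true, true) (true, true, false)
        placements placements + Bplace2 (R := R) ends o a₁ a₂ a₃ b s₁ s₂ s₃ F₀ z₀ τ
        (true, true, true) (true, false, true) placements placements ≤ Btriangle ends o a₁ a₂ a₃ b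
        s₁ s₂ s₃ F₀ z₀ τ + Bone (R := R) ends o a₁ a₂ a₃ b s₁ s₂ s₃ F₀ z₀ τ (true, true, true)) ∨
      (Bplace2 (R := R) ends o a₁ a₂ a₃ b s₁ s₂ s₃ F₀ z₀ τ (true, true, true) (true, true, false)
        placements placements + Bplace2 (R := R) ends o a₁ a₂ a₃ b s₁ s₂ s₃ F₀ z₀ τ
        (true, true, true) (false, true, true) placements placements ≤ Btriangle ends o a₁ a₂ a₃ b
        s₁ s₂ s₃ F₀ z₀ τ + Bone (R := R) ends o a₁ a₂ a₃ b s₁ s₂ s₃ F₀ z₀ τ (true, true, true)) ∨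
      (Bplace2 (R := R) ends o a₁ a₂ a₃ b s₁ s₂ s₃ F₀ z₀ τ (true, true, true) (true, false, true)
        placements placements + Bplace2 (R := R) ends o a₁ a₂ a₃ b s₁ s₂ s₃ F₀ z₀ τ
        (true, true, true) (false, true, true) placements placements ≤ Btriangle ends o a₁ a₂ a₃ b
        s₁ s₂ s₃ F₀ z₀ τ + Bone (R := R) ends o a₁ a₂ a₃ b s₁ s₂ s₃ F₀ z₀ τ (true, true, true)) :=
          by
  rw [pay222_iff_exists, refine_11_01, refine_11_02, refine_11_12, Btriangle_eq,
    Bthree_T_empty_eq_nestLeaf, Bthree_T_empty_eq_nestLeaf, Bthree_T_empty_eq_nestLeaf]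
  constructor
  · rintro ⟨p, hp, h⟩
    simp only [placements2, Finset.mem_insert, Finset.mem_singleton] at hp
    rcases hp with rfl | rfl | rfl
    · right; right; linarith
    · right; left; linarith
    · left; linarith
  · rintro (h | h | h)
    · exact ⟨(false, true, true), by simp [placements2], by linarith⟩
    · exact ⟨(true, false, true), by simp [placements2], by linarith⟩
    · exact ⟨(true, true, false), by simp [placements2], by linarith⟩

end Signs

end StarPattern

end Summit.Ventures.PercRepro2
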